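import Summits.ResolutionOfSingularities.ResolutionOfSingularities.Theorems.PurelyInseparableDim4ResConeGoodInvariant
import Summits.ResolutionOfSingularities.ResolutionOfSingularities.Theorems.PurelyInseparableDim4ResConeSatellitePair
import HarnessLib
import HarnessLib.Audit.Tags

/-!
# Purely inseparable four-folds — AT SHADE `p − 2` THE THREE-LETTER BRANCH IS THE LIGHT TRIPLE: a binary-cone tail with ≥ 3 boundary
# letters for ever has weights `(1,1,1)` from some time on, for every prime `p` (K2(p) lane, SLICE C, the `(p, p−2)` rung; branch (T) of
# `good_trichotomy`; file-holder res-dim4-p-5 g5)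

[OURS · counted 0 · cell `res-dim4-pi` · K2(p) lane, slice C (general-`p` programme; bus plan res-dim4-p-5 g5 2026-08-29 09:13Z) · seat p-5 g5.]
Nothing here proves K2(p) for any `p`, `NoIsolatedTrap p p` or resolution of singularities in dimension ≥ 4 / characteristic `p` — NOT
proved; pure weight bookkeeping plus FT.  AI kernel work, weaker than expert review.

`good_trichotomy` (p710770) locates every binary-cone tail in (G) «eventually GOOD» (the two-letter game), (B) «a permanent boundary letter» or
(T) «≥ 3 boundary letters for ever».  At shade `d = p − 2` the newborn letter weighs `|r| − 2`, and a state with ≥ 3 boundary letters comes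
from a step that KEPT ≥ 2 letters (mass ≥ 2), so along (T) the mass `|r|` never drops; bounded by the band, it is eventually constant; then
every step keeps exactly two letters of weight `1` and nothing else, so the states read `(|r| − 2, 1, 1, 0)`; if `|r| ≥ 4` the newborn (weight
`≥ 2`) is never kept, i.e. NO step is a satellite — against FT (`exists_satellite_ge`).  Hence `|r| ≡ 3`:
* `eventually_const_of_mono_bdd` — a non-decreasing bounded `ℕ`-sequence is eventually constant (bookkeeping);
* `subTwo_laws` — at `d + 2 = p`: `ord₀ F_m = |r_m| + d`, newborn weight `|r_m| − 2`, `|r_m| ≤ p`;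
* **`lightTriple_of_threeLetters_subTwo (p)`** — on a witnessed isolated above-floor `Step0 p` chain with `x^{r₀} ∣ F₀` and constant shade
  `p − 2` from `k₀`, if from `M ≥ k₀` on every state has ≥ 3 boundary letters, then from some `M′` on every state is the LIGHT TRIPLE
  (all weights `≤ 1`, `|r| = 3`) — the class res-dim4-p-1 g6's `…LightTripleAllPrimes` kills (then slice C(p, p−2) ⟺ (G) ∨ (B)).
No `e_G` hypothesis is needed here.
[cite: CossartJannsenSaito2020, Thm. 3.14, Lemma 13.2] [cite: HauserPerlega2019PRIMS, §2 (transform D′ of D)]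
bears_on: LADDER-RESOLUTION:D157-DOOR2 (res-dim4-pi · K2(p) = `RidgeBudget.NoAboveFloorTrap p p` · slice C(p, p−2), branch (T)).
Supports stmt-ResolutionOfSingularities-16155 (helper).
-/

set_option linter.dupNamespace false -- mandated namespace of this single-conjunct summit

noncomputable section

namespace Summit.ResolutionOfSingularities.ResolutionOfSingularities.Theorems.PIDim4

namespace ResCone

open MvPolynomial Finset
open Literature.AlgebraicGeometry.Resolution
open Literature.AlgebraicGeometry.Resolution.CentreBlowup
open Literature.AlgebraicGeometry.Resolution.Hauser2010
open Literature.AlgebraicGeometry.Resolution.HauserPerlega2019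

variable {K : Type} [Field K] [DecidableEq K] (p : ℕ) [Fact p.Prime]

omit [DecidableEq K] [Fact p.Prime] in
/-- A non-decreasing bounded sequence of naturals is eventually constant. [folklore] -/
theorem eventually_const_of_mono_bdd (f : ℕ → ℕ) (B : ℕ) (hmono : ∀ n, f n ≤ f (n + 1)) (hbdd : ∀ n, f n ≤ B) :
    ∃ N, ∀ n, N ≤ n → f n = f N := by
  -- induction on the room `B - f 0` left above the start, generalising `f`
  suffices H : ∀ k (g : ℕ → ℕ), (∀ n, g n ≤ g (n + 1)) → (∀ n, g n ≤ B) → B - g 0 ≤ k → ∃ N, ∀ n, N ≤ n → g n = g N from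
    H (B - f 0) f hmono hbdd le_rfl
  intro k
  induction k with
  | zero =>
    intro g hg hgb hk
    refine ⟨0, fun n _ => le_antisymm ?_ ?_⟩
    · have := hgb n; omega
    · -- monotone from 0 to n
      have hle : ∀ n, g 0 ≤ g n := fun n => by
        induction n with
        | zero => exact le_rfl
        | succ n ih => exact ih.trans (hg n)
      exact hle n
  | succ k ih =>
    intro g hg hgb hk
    by_cases hconst : ∀ n, g n = g 0
    · exact ⟨0, fun n _ => hconst n⟩
    · push Not at hconst
      obtain ⟨n₁, hn₁⟩ := hconst
      have hle : ∀ n, g 0 ≤ g n := fun n => by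
        induction n with
        | zero => exact le_rfl
        | succ n ih' => exact ih'.trans (hg n)
      have hlt : g 0 < g n₁ := lt_of_le_of_ne (hle n₁) (Ne.symm hn₁)
      obtain ⟨N, hN⟩ := ih (fun n => g (n₁ + n)) (fun n => by rw [show n₁ + (n + 1) = n₁ + n + 1 by ring]; exact hg _)
        (fun n => hgb _) (by have := hgb n₁; simp only [Nat.add_zero]; omega)
      refine ⟨n₁ + N, fun n hn => ?_⟩
      obtain ⟨m, rfl⟩ := Nat.exists_eq_add_of_le hn
      have h := hN (N + m) (by omega)
      rw [show n₁ + (N + m) = n₁ + N + m by ring] at h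
      exact h

/-- **THE SHADE-`(p − 2)` LAWS**: `ord₀ F_m = |r_m| + d`, the newborn weighs `|r_m| − 2`, and `|r_m| ≤ p`. [OURS · bookkeeping]
[cite: HauserPerlega2019PRIMS, §2 (transform D′ of D)] -/
theorem subTwo_laws {c : ℕ → State K} {j : ℕ → Fin 4} {b : ℕ → Fin 4 → K}
    (hc : ∀ k, IsIsolated p (c k).F ∧ Step0 p (c k) (c (k + 1))) (hw : FreeTail.IsWitnessedChain p c j b)
    (hr0 : ∀ e ∈ (c 0).F.support, (c 0).r ≤ e) (hfloor : ∀ k, ordZero (c k).F ≠ p) {k₀ d : ℕ} (hd : d + 2 = p)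
    (hshade : ∀ k, k₀ ≤ k → (c k).shade = (d : ℕ∞)) {m : ℕ} (hm : k₀ ≤ m) :
    ordZero (c m).F = (((c m).r.degree + d : ℕ) : ℕ∞) ∧ (c (m + 1)).r (j m) = (c m).r.degree - 2 ∧ (c m).r.degree ≤ p := by
  obtain ⟨o, ho, hpo, -, hod⟩ := chain_shade_nat p hc hfloor hshade hm
  obtain ⟨o', ho', -, ho'2⟩ := BandShade.exists_ordZero_eq p hc m
  have hoo' : o = o' := by have h := ho.symm.trans ho'; exact_mod_cast h
  have hro := degree_r_le ho (IsolatedBand.isolated_chain_forall_le hc hr0 m)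
  have hord : ordZero (c m).F = (((c m).r.degree + d : ℕ) : ℕ∞) := by rw [ho]; congr 1; omega
  refine ⟨hord, ?_, by omega⟩
  rw [(hw m).2.2.2.2, step_r_univ' p (j m) (b m) (c m) hord, Finsupp.coe_update, Function.update_self]
  omega

/-- **AT SHADE `p − 2`, THREE LETTERS FOR EVER MEANS THE LIGHT TRIPLE.**  On a witnessed isolated above-floor `Step0 p` chain with
`x^{r₀} ∣ F₀` and constant shade `d = p − 2` from `k₀`: if from `M ≥ k₀` on every state has at least three boundary letters, then from
some `M′ ≥ M` on every state has all weights `≤ 1` and `|r| = 3`. (Mass non-decreasing and bounded ⇒ constant; then every step keeps exactly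
two weight-`1` letters; a newborn of weight `≥ 2` would never be kept — no satellites, against FT.) [OURS]
[cite: CossartJannsenSaito2020, Thm. 3.14, Lemma 13.2] -/
theorem lightTriple_of_threeLetters_subTwo [CharP K p] {c : ℕ → State K} {j : ℕ → Fin 4} {b : ℕ → Fin 4 → K}
    (hc : ∀ k, IsIsolated p (c k).F ∧ Step0 p (c k) (c (k + 1))) (hw : FreeTail.IsWitnessedChain p c j b)
    (hr0 : ∀ e ∈ (c 0).F.support, (c 0).r ≤ e) (hfloor : ∀ k, ordZero (c k).F ≠ p) {k₀ d : ℕ} (hd : d + 2 = p)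
    (hshade : ∀ k, k₀ ≤ k → (c k).shade = (d : ℕ∞)) {M : ℕ} (hM : k₀ ≤ M)
    (hT : ∀ m, M ≤ m → ¬ ∃ x y : Fin 4, ∀ i, i ≠ x → i ≠ y → (c m).r i = 0) :
    ∃ M', M ≤ M' ∧ ∀ m, M' ≤ m → (∀ i, (c m).r i ≤ 1) ∧ (c m).r.degree = 3 := by
  have hlaw := fun m i (hi : i ≠ j m) => succ_r_apply_of_ne' p hc hw hfloor m hi
  -- two kept letters of weight ≥ 1 behind every three-letter state
  have hkept2 : ∀ m, M ≤ m → ∃ i₁ i₂ : Fin 4, i₁ ≠ i₂ ∧ i₁ ≠ j m ∧ i₂ ≠ j m ∧ b m i₁ = 0 ∧ b m i₂ = 0 ∧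
      1 ≤ (c m).r i₁ ∧ 1 ≤ (c m).r i₂ ∧ (c (m + 1)).r i₁ = (c m).r i₁ ∧ (c (m + 1)).r i₂ = (c m).r i₂ := by
    intro m hm
    have h3 := hT (m + 1) (by omega)
    push Not at h3
    obtain ⟨i₁, hi₁j, -, hi₁⟩ := h3 (j m) (j m)
    obtain ⟨i₂, hi₂j, hi₂i₁, hi₂⟩ := h3 (j m) i₁
    have hk : ∀ i, i ≠ j m → (c (m + 1)).r i ≠ 0 → b m i = 0 ∧ 1 ≤ (c m).r i ∧ (c (m + 1)).r i = (c m).r i := by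
      intro i hi hri
      rw [hlaw m i hi] at hri ⊢
      by_cases hb : b m i = 0
      · rw [if_pos hb] at hri ⊢; exact ⟨hb, by omega, rfl⟩
      · rw [if_neg hb] at hri; exact absurd rfl hri
    obtain ⟨hb₁, hr₁, he₁⟩ := hk i₁ hi₁j hi₁
    obtain ⟨hb₂, hr₂, he₂⟩ := hk i₂ hi₂j hi₂
    exact ⟨i₁, i₂, Ne.symm hi₂i₁, hi₁j, hi₂j, hb₁, hb₂, hr₁, hr₂, he₁, he₂⟩
  -- the mass is non-decreasing from `M` and bounded by `p`
  have hmono : ∀ n, (c (M + n)).r.degree ≤ (c (M + n + 1)).r.degree := by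
    intro n
    obtain ⟨i₁, i₂, h12, h1j, h2j, -, -, hr₁, hr₂, he₁, he₂⟩ := hkept2 (M + n) (by omega)
    obtain ⟨-, hnew, -⟩ := subTwo_laws p hc hw hr0 hfloor hd hshade (m := M + n) (by omega)
    have h := apply_add_apply_add_apply_le_degree ((c (M + n + 1)).r) (Ne.symm h1j) (Ne.symm h2j) h12
    omega
  obtain ⟨N, hN⟩ := eventually_const_of_mono_bdd (fun n => (c (M + n)).r.degree) p hmono
    (fun n => (subTwo_laws p hc hw hr0 hfloor hd hshade (m := M + n) (by omega)).2.2)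
  -- from `M + N` on the mass is the constant `s`
  set s := (c (M + N)).r.degree with hs
  have hconst : ∀ m, M + N ≤ m → (c m).r.degree = s := by
    intro m hm
    obtain ⟨n, rfl⟩ := Nat.exists_eq_add_of_le hm
    have h := hN (N + n) (by omega)
    rw [show M + (N + n) = M + N + n by ring] at h
    exact h
  -- the shape of every state `m + 1 > M + N`: newborn `s − 2`, two kept letters of weight `1`, the fourth letter `0`
  have hshape : ∀ m, M + N ≤ m → ∃ i₁ i₂ : Fin 4, i₁ ≠ i₂ ∧ i₁ ≠ j m ∧ i₂ ≠ j m ∧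
      (c (m + 1)).r (j m) = s - 2 ∧ (c (m + 1)).r i₁ = 1 ∧ (c (m + 1)).r i₂ = 1 ∧
      (∀ i, i ≠ j m → i ≠ i₁ → i ≠ i₂ → (c (m + 1)).r i = 0) ∧ 3 ≤ s := by
    intro m hm
    obtain ⟨i₁, i₂, h12, h1j, h2j, -, -, hr₁, hr₂, he₁, he₂⟩ := hkept2 m (by omega)
    obtain ⟨-, hnew, -⟩ := subTwo_laws p hc hw hr0 hfloor hd hshade (m := m) (by omega)
    have hsm := hconst m hm
    have hsm1 := hconst (m + 1) (by omega)
    -- the fourth letter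
    obtain ⟨i₃, hi₃j, hi₃1, hi₃2⟩ : ∃ i₃ : Fin 4, i₃ ≠ j m ∧ i₃ ≠ i₁ ∧ i₃ ≠ i₂ := by
      have : ∀ a b c : Fin 4, ∃ i : Fin 4, i ≠ a ∧ i ≠ b ∧ i ≠ c := by decide
      exact this (j m) i₁ i₂
    have hcover : ∀ x : Fin 4, x = j m ∨ x = i₁ ∨ x = i₂ ∨ x = i₃ := by
      have : ∀ a b c d x : Fin 4, a ≠ b → a ≠ c → a ≠ d → b ≠ c → b ≠ d → c ≠ d →
          (x = a ∨ x = b ∨ x = c ∨ x = d) := by decide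
      exact fun x => this (j m) i₁ i₂ i₃ x (Ne.symm h1j) (Ne.symm h2j) (Ne.symm hi₃j) h12 (Ne.symm hi₃1) (Ne.symm hi₃2)
    have hsum : (c (m + 1)).r.degree = (c (m + 1)).r (j m) + (c (m + 1)).r i₁ + (c (m + 1)).r i₂ + (c (m + 1)).r i₃ := by
      have huniv : (Finset.univ : Finset (Fin 4)) = {j m, i₁, i₂, i₃} := by
        ext x
        simp only [Finset.mem_univ, Finset.mem_insert, Finset.mem_singleton, true_iff]
        exact hcover x
      rw [Finsupp.degree_eq_sum, huniv, Finset.sum_insert, Finset.sum_insert, Finset.sum_pair (Ne.symm hi₃2)]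
      · ring
      · simp only [Finset.mem_insert, Finset.mem_singleton, not_or]; exact ⟨h12, Ne.symm hi₃1⟩
      · simp only [Finset.mem_insert, Finset.mem_singleton, not_or]; exact ⟨Ne.symm h1j, Ne.symm h2j, Ne.symm hi₃j⟩
    have h3 : 3 ≤ s := by
      have h := apply_add_apply_add_apply_le_degree ((c (m + 1)).r) (Ne.symm h1j) (Ne.symm h2j) h12
      have := one_le_succ_r_chart p hc hw hfloor m
      omega
    refine ⟨i₁, i₂, h12, h1j, h2j, by omega, by omega, by omega, fun i hi hi1 hi2 => ?_, h3⟩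
    have hii₃ : i = i₃ := by
      rcases hcover i with h | h | h | h
      · exact absurd h hi
      · exact absurd h hi1
      · exact absurd h hi2
      · exact h
    rw [hii₃]; omega
  -- if `s ≥ 4`, no step after `M + N` is a satellite: contradiction with FT
  have hs3 : s = 3 := by
    by_contra hne
    obtain ⟨k, hk, hsat⟩ := exists_satellite_ge p hc hw (M + N)
    obtain ⟨i₁, i₂, h12, h1j, h2j, hnew, h1, h2, hoth, h3⟩ := hshape k hk
    -- the newborn `j k` (weight `s − 2 ≥ 2` at `k + 1`) is kept at step `k + 1` (satellite): too much mass at `k + 2`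
    obtain ⟨i₁', i₂', h12', h1j', h2j', -, -, hr₁', hr₂', he₁', he₂'⟩ := hkept2 (k + 1) (by omega)
    obtain ⟨-, hnew', -⟩ := subTwo_laws p hc hw hr0 hfloor hd hshade (m := k + 1) (by omega)
    rw [show k + 1 + 1 = k + 2 by ring] at he₁' he₂' hnew'
    have hsk1 := hconst (k + 1) (by omega)
    have hsk2 := hconst (k + 2) (by omega)
    have hkeptj : (c (k + 2)).r (j k) = s - 2 := by
      rw [hlaw (k + 1) (j k) hsat.1.symm, if_pos hsat.2, hnew]
    -- `j k`, `i₁'`, `i₂'`, `j (k+1)`: the kept pair has weight ≥ 1 each, the newborn `s − 2`, and `j k` weighs `s − 2`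
    by_cases hj1 : j k = i₁'
    · -- then `i₂'` is a further kept letter of weight ≥ 1
      have h := apply_add_apply_add_apply_le_degree ((c (k + 2)).r) (a := j (k + 1)) (b := i₁') (c := i₂') (Ne.symm h1j')
        (Ne.symm h2j') h12'
      rw [hj1] at hkeptj
      omega
    · by_cases hj2 : j k = i₂'
      · have h := apply_add_apply_add_apply_le_degree ((c (k + 2)).r) (a := j (k + 1)) (b := i₁') (c := i₂') (Ne.symm h1j')
          (Ne.symm h2j') h12'
        rw [hj2] at hkeptj
        omega
      · have h := apply_add_apply_add_apply_le_degree ((c (k + 2)).r) (a := j (k + 1)) (b := j k) (c := i₁') hsat.1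
          (Ne.symm h1j') hj1
        omega
  -- conclusion from `M + N + 1` on
  refine ⟨M + N + 1, by omega, fun m hm => ?_⟩
  obtain ⟨m₀, rfl⟩ : ∃ m₀, m = m₀ + 1 := ⟨m - 1, by omega⟩
  obtain ⟨i₁, i₂, h12, h1j, h2j, hnew, h1, h2, hoth, -⟩ := hshape m₀ (by omega)
  refine ⟨fun i => ?_, by rw [hconst (m₀ + 1) (by omega), hs3]⟩
  by_cases hij : i = j m₀
  · rw [hij, hnew, hs3]
  · by_cases hi1 : i = i₁
    · rw [hi1, h1]
    · by_cases hi2 : i = i₂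
      · rw [hi2, h2]
      · rw [hoth i hij hi1 hi2]; exact Nat.zero_le _

end ResCone

end Summit.ResolutionOfSingularities.ResolutionOfSingularities.Theorems.PIDim4

end
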